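import Summits.KontsevichZagierPeriods.KontsevichZagierPeriods.Theses.TerasomaMultiplication
import Summits.KontsevichZagierPeriods.KontsevichZagierPeriods.Theorems.MultiplicationThree.Negative.Pinned
import Summits.KontsevichZagierPeriods.KontsevichZagierPeriods.Theorems.MultiplicationThree.Negative.BolzaLever
import Literature.NumberTheory.Transcendental.KZMellinFibres
import Literature.NumberTheory.Transcendental.KZSubcalculusInvariants
import Literature.NumberTheory.Transcendental.KZDominatedFamilyRelations
import Literature.NumberTheory.Transcendental.KZLogCalculusProofs
import Literature.NumberTheory.Transcendental.KZSemialgebraicComplex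
import Mathlib.Analysis.SpecialFunctions.Pow.Deriv

/-!
# `MultiplicationThree` (stmt-KontsevichZagierPeriods-3598), line `bolza-involution-real-quotient`:
# stub S2, auxiliary file 2 — derivative, Jacobian and semialgebraicity of the cube-root chart

For the chart `Φ(u,v) = (u, a(u,v))`, `a = −(z−1)²/z`, `z = (v(1−v)/(1−u−v))^{1/3}` of stub
`stub_lowerCellToNegativeBranch` (`u = x 0`, `v = x 1`) this file supplies the ANALYTIC data of the
rule-(2) move `[lowerCell, u^{s−1}(ψ+ψ̄)/2] ~ [Σ_neg, (3/2)u^{s−1}/√Q]`: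

* `Φ` is differentiable on the open sheared box `{0<u, 0<v<1−u}` with a Jacobian `D x` of the shape
  `[[1, 0], [∂a/∂u, ∂a/∂v]]`, so that `det D x = ∂a/∂v` is the `v`-derivative of the one-variable
  slice of the chart (`s2_hasFDerivAt_chart`; no closed form of the partial derivatives is needed:
  the Jacobian is assembled from `fderiv` of the second component);
* on the lower cell `u < (1−v)²` this determinant is POSITIVE and equals `√Q(a,u)·(ψ+ψ̄)/3`,
  `Q(a,u) = a²(3−a)² − 4ua` (`s2_det_chart`): this is the tree's exact Bolza lever
  `bolza_lever` (`D² = Q·((ψ+ψ̄)/3)²`) together with the sign lemma `bolza_chart_deriv_sign`;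
* the chart, the cells and the target density `(3/2)u^{s−1}/√Q` on `Σ_neg = {0<u<1, a<0}` are
  `ℚ`-semialgebraic (rational powers of positive polynomials, Tarski–Seidenberg closure).

Nothing is defined in this file: the cells, the chart and the densities are written out.

References: M. Kontsevich, D. Zagier, *Periods* (2001), §1.2 rule (2).
-/

noncomputable section

open Set MvPolynomial
open Literature.NumberTheory.Transcendental Literature.NumberTheory.Transcendental.KZ
open Literature.ModelTheory.ExponentialFields (IsSemialgebraic)

namespace Summit.KontsevichZagierPeriods.TerasomaMultiplication.MultiplicationThreeBolza

open Summit.KontsevichZagierPeriods.TerasomaMultiplication.MultiplicationThreeNegative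

/-! ### Differentiability of the chart -/

/-- The second component `a(u,v) = −(z−1)²/z`, `z = (v(1−v)/(1−u−v))^{1/3}`, of the chart is
differentiable on the open sheared box (a rational function, a real power of a positive function,
and a rational function of that). [folklore] -/
theorem s2_differentiableAt_chart₂ {x : Fin 2 → ℝ} (h0 : 0 < x 0) (h1 : 0 < x 1) (h2 : x 1 < 1 - x 0) :
    DifferentiableAt ℝ (fun y : Fin 2 → ℝ =>
      -((y 1 * (1 - y 1) / (1 - y 0 - y 1)) ^ ((1:ℝ)/3) - 1) ^ 2 /
        (y 1 * (1 - y 1) / (1 - y 0 - y 1)) ^ ((1:ℝ)/3)) x := by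
  have hN : 0 < 1 - x 0 - x 1 := by linarith
  have h1v : 0 < 1 - x 1 := by linarith
  have hg : 0 < x 1 * (1 - x 1) / (1 - x 0 - x 1) := div_pos (mul_pos h1 h1v) hN
  have d0 : DifferentiableAt ℝ (fun y : Fin 2 → ℝ => y 0) x := (hasFDerivAt_apply 0 x).differentiableAt
  have d1 : DifferentiableAt ℝ (fun y : Fin 2 → ℝ => y 1) x := (hasFDerivAt_apply 1 x).differentiableAt
  have dnum : DifferentiableAt ℝ (fun y : Fin 2 → ℝ => y 1 * (1 - y 1)) x := d1.mul (d1.const_sub 1)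
  have dden : DifferentiableAt ℝ (fun y : Fin 2 → ℝ => 1 - y 0 - y 1) x := (d0.const_sub 1).sub d1
  have dG : DifferentiableAt ℝ (fun y : Fin 2 → ℝ => y 1 * (1 - y 1) / (1 - y 0 - y 1)) x := by
    have e : (fun y : Fin 2 → ℝ => y 1 * (1 - y 1) / (1 - y 0 - y 1)) =
        fun y => y 1 * (1 - y 1) * (1 - y 0 - y 1)⁻¹ := funext fun y => div_eq_mul_inv _ _
    rw [e]
    exact dnum.mul (dden.fun_inv hN.ne')
  have dz : DifferentiableAt ℝ (fun y : Fin 2 → ℝ => (y 1 * (1 - y 1) / (1 - y 0 - y 1)) ^ ((1:ℝ)/3)) x :=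
    dG.rpow_const (Or.inl hg.ne')
  have hz0 : (x 1 * (1 - x 1) / (1 - x 0 - x 1)) ^ ((1:ℝ)/3) ≠ 0 := (Real.rpow_pos_of_pos hg _).ne'
  have e : (fun y : Fin 2 → ℝ =>
      -((y 1 * (1 - y 1) / (1 - y 0 - y 1)) ^ ((1:ℝ)/3) - 1) ^ 2 /
        (y 1 * (1 - y 1) / (1 - y 0 - y 1)) ^ ((1:ℝ)/3)) =
      fun y => -((y 1 * (1 - y 1) / (1 - y 0 - y 1)) ^ ((1:ℝ)/3) - 1) ^ 2 *
        ((y 1 * (1 - y 1) / (1 - y 0 - y 1)) ^ ((1:ℝ)/3))⁻¹ := funext fun y => div_eq_mul_inv _ _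
  rw [e]
  exact ((dz.sub_const 1).pow 2).neg.mul (dz.fun_inv hz0)

/-- **The chart is differentiable, with `det = ∂a/∂v`.** There is a Jacobian field `D` such that at
every point of the open sheared box `Φ(u,v) = (u, a(u,v))` has derivative `D x`, and `det (D x)` is
the derivative at `v = x 1` of the one-variable slice `t ↦ a(x 0, t)` (written exactly as in the
tree's `bolza_lever`). [folklore] -/
theorem s2_hasFDerivAt_chart : ∃ D : (Fin 2 → ℝ) → (Fin 2 → ℝ) →L[ℝ] (Fin 2 → ℝ),
    ∀ x : Fin 2 → ℝ, 0 < x 0 → 0 < x 1 → x 1 < 1 - x 0 →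
      HasFDerivAt (fun y : Fin 2 → ℝ => (![y 0,
          -((y 1 * (1 - y 1) / (1 - y 0 - y 1)) ^ ((1:ℝ)/3) - 1) ^ 2 /
            (y 1 * (1 - y 1) / (1 - y 0 - y 1)) ^ ((1:ℝ)/3)] : Fin 2 → ℝ)) (D x) x ∧
        HasDerivAt (fun t : ℝ => -((t * (1 - t) / (1 - x 0 - t)) ^ ((1:ℝ)/3) - 1) ^ 2 /
            (t * (1 - t) / (1 - x 0 - t)) ^ ((1:ℝ)/3)) ((D x).det) (x 1) := by
  classical
  -- the second component and its Fréchet derivative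
  set A : (Fin 2 → ℝ) → ℝ := fun y =>
    -((y 1 * (1 - y 1) / (1 - y 0 - y 1)) ^ ((1:ℝ)/3) - 1) ^ 2 /
      (y 1 * (1 - y 1) / (1 - y 0 - y 1)) ^ ((1:ℝ)/3) with hA
  set e0 : Fin 2 → ℝ := Pi.single 0 1 with he0
  set e1 : Fin 2 → ℝ := Pi.single 1 1 with he1
  refine ⟨fun x => LinearMap.toContinuousLinearMap
    (Matrix.toLin' !![(1:ℝ), 0; fderiv ℝ A x e0, fderiv ℝ A x e1]), fun x h0 h1 h2 => ?_⟩
  have hAd : HasFDerivAt A (fderiv ℝ A x) x :=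
    (s2_differentiableAt_chart₂ h0 h1 h2).hasFDerivAt
  have hdet : (LinearMap.toContinuousLinearMap
      (Matrix.toLin' !![(1:ℝ), 0; fderiv ℝ A x e0, fderiv ℝ A x e1])).det = fderiv ℝ A x e1 := by
    change LinearMap.det (Matrix.toLin' !![(1:ℝ), 0; fderiv ℝ A x e0, fderiv ℝ A x e1]) = _
    rw [LinearMap.det_toLin', Matrix.det_fin_two]
    simp
  have hvec : ∀ v : Fin 2 → ℝ, v = v 0 • e0 + v 1 • e1 := fun v => by
    funext i; fin_cases i <;> simp [he0, he1]
  refine ⟨?_, ?_⟩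
  · rw [hasFDerivAt_pi']
    refine Fin.forall_fin_two.mpr ⟨?_, ?_⟩
    · have hp : HasFDerivAt (fun y : Fin 2 → ℝ => y 0)
          (ContinuousLinearMap.proj (R := ℝ) (φ := fun _ : Fin 2 => ℝ) 0) x := hasFDerivAt_apply 0 x
      refine (hp.congr_fderiv (ContinuousLinearMap.ext fun v => ?_)).congr_of_eventuallyEq ?_
      · simp [Matrix.toLin'_apply, dotProduct, Fin.sum_univ_two]
      · exact Filter.Eventually.of_forall fun y => rfl
    · have hf : (fun y : Fin 2 → ℝ => (![y 0, A y] : Fin 2 → ℝ) 1) = A := funext fun y => rfl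
      show HasFDerivAt (fun y : Fin 2 → ℝ => (![y 0, A y] : Fin 2 → ℝ) 1) _ x
      rw [hf]
      refine hAd.congr_fderiv (ContinuousLinearMap.ext fun v => ?_)
      conv_lhs => rw [hvec v]
      rw [map_add, map_smul, map_smul]
      simp [Matrix.toLin'_apply, dotProduct, Fin.sum_univ_two, mul_comm]
  · rw [hdet]
    -- the slice is `A ∘ γ`, `γ t = x + (t − x 1) • e1`
    have hγ : HasDerivAt (fun t : ℝ => x + (t - x 1) • e1) e1 (x 1) := by
      have := (((hasDerivAt_id (x 1)).sub_const (x 1)).smul_const e1).const_add x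
      simpa using this
    have hγx : x + (x 1 - x 1) • e1 = x := by simp
    have hcomp : HasDerivAt (A ∘ fun t : ℝ => x + (t - x 1) • e1) (fderiv ℝ A x e1) (x 1) := by
      have hAd' : HasFDerivAt A (fderiv ℝ A x) (x + (x 1 - x 1) • e1) := by rw [hγx]; exact hAd
      exact hAd'.comp_hasDerivAt (x 1) hγ
    have hγ0 : ∀ t : ℝ, (x + (t - x 1) • e1) 0 = x 0 := fun t => by simp [he1]
    have hγ1 : ∀ t : ℝ, (x + (t - x 1) • e1) 1 = t := fun t => by simp [he1]
    have hfun : (A ∘ fun t : ℝ => x + (t - x 1) • e1) = fun t : ℝ =>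
        -((t * (1 - t) / (1 - x 0 - t)) ^ ((1:ℝ)/3) - 1) ^ 2 /
          (t * (1 - t) / (1 - x 0 - t)) ^ ((1:ℝ)/3) := by
      funext t
      simp only [Function.comp_apply, hA, hγ0, hγ1]
    rw [hfun] at hcomp
    exact hcomp

/-- On the lower cell the chart value `a = −(z−1)²/z` is negative (`0 < z < 1`; stated with the
four cell inequalities as separate hypotheses). [folklore] -/
theorem s2_chart_neg_of {x : Fin 2 → ℝ} (h0 : 0 < x 0) (h1 : 0 < x 1) (h2 : x 1 < 1 - x 0)
    (h3 : x 0 < (1 - x 1) ^ 2) :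
    -((x 1 * (1 - x 1) / (1 - x 0 - x 1)) ^ ((1:ℝ)/3) - 1) ^ 2 /
        (x 1 * (1 - x 1) / (1 - x 0 - x 1)) ^ ((1:ℝ)/3) < 0 := by
  have hN : 0 < 1 - x 0 - x 1 := by linarith
  have h1v : 0 < 1 - x 1 := by linarith
  have hg : 0 < x 1 * (1 - x 1) / (1 - x 0 - x 1) := div_pos (mul_pos h1 h1v) hN
  have hz : 0 < (x 1 * (1 - x 1) / (1 - x 0 - x 1)) ^ ((1:ℝ)/3) := Real.rpow_pos_of_pos hg _
  have hz1 : (x 1 * (1 - x 1) / (1 - x 0 - x 1)) ^ ((1:ℝ)/3) < 1 :=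
    (bolza_chart_lt_one_iff h0 h1 h2).mpr h3
  apply div_neg_of_neg_of_pos _ hz
  have : (x 1 * (1 - x 1) / (1 - x 0 - x 1)) ^ ((1:ℝ)/3) - 1 ≠ 0 := by linarith
  have : 0 < ((x 1 * (1 - x 1) / (1 - x 0 - x 1)) ^ ((1:ℝ)/3) - 1) ^ 2 := by positivity
  linarith

/-- **The Jacobian on the lower cell.** For the Jacobian field of `s2_hasFDerivAt_chart` (indeed for
any `J` which is the `v`-derivative of the slice), on the lower cell `u < (1−v)²`:
`0 < J` and `J = √Q(a,u) · (ψ+ψ̄)/3`, where `a = a(u,v)` is the chart value,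
`Q(a,u) = a²(3−a)² − 4ua`, `ψ = v^{−2/3}(1−v)^{−2/3}(1−u−v)^{−1/3}`,
`ψ̄ = v^{−1/3}(1−v)^{−1/3}(1−u−v)^{−2/3}` — the tree's `bolza_lever` and `bolza_chart_deriv_sign`.
[folklore] -/
theorem s2_det_chart {x : Fin 2 → ℝ} {J : ℝ}
    (hx : x ∈ {x : Fin 2 → ℝ | 0 < x 0 ∧ 0 < x 1 ∧ x 1 < 1 - x 0 ∧ x 0 < (1 - x 1) ^ 2})
    (hJ : HasDerivAt (fun t : ℝ => -((t * (1 - t) / (1 - x 0 - t)) ^ ((1:ℝ)/3) - 1) ^ 2 /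
            (t * (1 - t) / (1 - x 0 - t)) ^ ((1:ℝ)/3)) J (x 1)) :
    0 < J ∧
    0 < (-((x 1 * (1 - x 1) / (1 - x 0 - x 1)) ^ ((1:ℝ)/3) - 1) ^ 2 /
              (x 1 * (1 - x 1) / (1 - x 0 - x 1)) ^ ((1:ℝ)/3)) ^ 2 *
            (3 - -((x 1 * (1 - x 1) / (1 - x 0 - x 1)) ^ ((1:ℝ)/3) - 1) ^ 2 /
              (x 1 * (1 - x 1) / (1 - x 0 - x 1)) ^ ((1:ℝ)/3)) ^ 2 -
          4 * x 0 * (-((x 1 * (1 - x 1) / (1 - x 0 - x 1)) ^ ((1:ℝ)/3) - 1) ^ 2 /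
              (x 1 * (1 - x 1) / (1 - x 0 - x 1)) ^ ((1:ℝ)/3)) ∧
    J = Real.sqrt ((-((x 1 * (1 - x 1) / (1 - x 0 - x 1)) ^ ((1:ℝ)/3) - 1) ^ 2 /
              (x 1 * (1 - x 1) / (1 - x 0 - x 1)) ^ ((1:ℝ)/3)) ^ 2 *
            (3 - -((x 1 * (1 - x 1) / (1 - x 0 - x 1)) ^ ((1:ℝ)/3) - 1) ^ 2 /
              (x 1 * (1 - x 1) / (1 - x 0 - x 1)) ^ ((1:ℝ)/3)) ^ 2 -
          4 * x 0 * (-((x 1 * (1 - x 1) / (1 - x 0 - x 1)) ^ ((1:ℝ)/3) - 1) ^ 2 /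
              (x 1 * (1 - x 1) / (1 - x 0 - x 1)) ^ ((1:ℝ)/3))) *
        ((x 1 ^ (-(2:ℝ)/3) * (1 - x 1) ^ (-(2:ℝ)/3) * (1 - x 0 - x 1) ^ (-(1:ℝ)/3) +
            x 1 ^ (-(1:ℝ)/3) * (1 - x 1) ^ (-(1:ℝ)/3) * (1 - x 0 - x 1) ^ (-(2:ℝ)/3)) / 3) := by
  obtain ⟨h0, h1, h2, h3⟩ := hx
  have hu1 : x 0 < 1 := by nlinarith
  obtain ⟨D, hD, hsq⟩ := bolza_lever h0 h1 h2
  have hDJ : D = J := hD.unique hJ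
  subst hDJ
  have hpos : 0 < D := (bolza_chart_deriv_sign h0 hu1 h1 h2 hD).1 h3
  -- abbreviations
  set a := -((x 1 * (1 - x 1) / (1 - x 0 - x 1)) ^ ((1:ℝ)/3) - 1) ^ 2 /
    (x 1 * (1 - x 1) / (1 - x 0 - x 1)) ^ ((1:ℝ)/3) with ha
  set k := (x 1 ^ (-(2:ℝ)/3) * (1 - x 1) ^ (-(2:ℝ)/3) * (1 - x 0 - x 1) ^ (-(1:ℝ)/3) +
    x 1 ^ (-(1:ℝ)/3) * (1 - x 1) ^ (-(1:ℝ)/3) * (1 - x 0 - x 1) ^ (-(2:ℝ)/3)) / 3 with hk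
  have hN : 0 < 1 - x 0 - x 1 := by linarith
  have h1v : 0 < 1 - x 1 := by linarith
  have hk0 : 0 < k := by positivity
  have ha0 : a < 0 := s2_chart_neg_of h0 h1 h2 h3
  have hQ : 0 < a ^ 2 * (3 - a) ^ 2 - 4 * x 0 * a := by
    have : 0 ≤ a ^ 2 * (3 - a) ^ 2 := by positivity
    nlinarith [mul_pos h0 (neg_pos.mpr ha0)]
  refine ⟨hpos, hQ, ?_⟩
  have hD2 : D = Real.sqrt (D ^ 2) := (Real.sqrt_sq hpos.le).symm
  rw [hD2, hsq, Real.sqrt_mul hQ.le, Real.sqrt_sq hk0.le]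

/-! ### Semialgebraicity -/

/-- The lower cell is `ℚ`-semialgebraic. [folklore] -/
theorem s2_isSemialgebraic_lowerCell :
    IsSemialgebraic ℚ {x : Fin 2 → ℝ | 0 < x 0 ∧ 0 < x 1 ∧ x 1 < 1 - x 0 ∧ x 0 < (1 - x 1) ^ 2} := by
  convert isSemialgebraic_setOf_forall_aeval_pos
    (![X 0, X 1, 1 - X 0 - X 1, (1 - X 1) ^ 2 - X 0] : Fin 4 → MvPolynomial (Fin 2) ℚ) using 1
  ext x
  simp only [mem_setOf_eq, Fin.forall_fin_succ, Matrix.cons_val_zero, Matrix.cons_val_succ,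
    map_sub, map_one, map_pow, MvPolynomial.aeval_X, IsEmpty.forall_iff, and_true]
  constructor
  · rintro ⟨h0, h1, h2, h3⟩; exact ⟨h0, h1, by linarith, by linarith⟩
  · rintro ⟨h0, h1, h2, h3⟩; exact ⟨h0, h1, by linarith, by linarith⟩

/-- The cube root `z = (v(1−v)/(1−u−v))^{1/3}` is `ℚ`-semialgebraic on the lower cell (it is the
Euler–Mellin monomial `v^{1/3}(1−v)^{1/3}(1−u−v)^{−1/3}`). [folklore] -/
theorem s2_isSemialgebraicFunOn_cbrt :
    IsSemialgebraicFunOn ℚ {x : Fin 2 → ℝ | 0 < x 0 ∧ 0 < x 1 ∧ x 1 < 1 - x 0 ∧ x 0 < (1 - x 1) ^ 2}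
      (fun y : Fin 2 → ℝ => (y 1 * (1 - y 1) / (1 - y 0 - y 1)) ^ ((1:ℝ)/3)) := by
  have hmel := isSemialgebraicFunOn_mellinIntegrand s2_isSemialgebraic_lowerCell
    (![X 1, 1 - X 1, 1 - X 0 - X 1] : Fin 3 → MvPolynomial (Fin 2) ℚ) (![1/3, 1/3, -1/3]) 1 ?_
  · refine hmel.congr fun x hx => ?_
    obtain ⟨h0, h1, h2, -⟩ := hx
    have hN : 0 < 1 - x 0 - x 1 := by linarith
    have h1v : 0 < 1 - x 1 := by linarith
    rw [Real.div_rpow (mul_pos h1 h1v).le hN.le, Real.mul_rpow h1.le h1v.le,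
      div_eq_mul_inv (x 1 ^ ((1:ℝ)/3) * (1 - x 1) ^ ((1:ℝ)/3)) ((1 - x 0 - x 1) ^ ((1:ℝ)/3)),
      ← Real.rpow_neg hN.le]
    simp only [mellinIntegrand, Fin.prod_univ_three, Matrix.cons_val_zero, Matrix.cons_val_one,
      Matrix.cons_val, map_sub, map_one, MvPolynomial.aeval_X]
    norm_num
  · intro x hx k
    obtain ⟨h0, h1, h2, -⟩ := hx
    fin_cases k <;> simp <;> linarith

/-- The chart value `a = −(z−1)²/z` is `ℚ`-semialgebraic on the lower cell. [folklore] -/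
theorem s2_isSemialgebraicFunOn_chart₂ :
    IsSemialgebraicFunOn ℚ {x : Fin 2 → ℝ | 0 < x 0 ∧ 0 < x 1 ∧ x 1 < 1 - x 0 ∧ x 0 < (1 - x 1) ^ 2}
      (fun y : Fin 2 → ℝ => -((y 1 * (1 - y 1) / (1 - y 0 - y 1)) ^ ((1:ℝ)/3) - 1) ^ 2 /
        (y 1 * (1 - y 1) / (1 - y 0 - y 1)) ^ ((1:ℝ)/3)) := by
  have hz := s2_isSemialgebraicFunOn_cbrt
  have h1 : IsSemialgebraicFunOn ℚ {x : Fin 2 → ℝ | 0 < x 0 ∧ 0 < x 1 ∧ x 1 < 1 - x 0 ∧ x 0 < (1 - x 1) ^ 2}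
      (fun _ => (1:ℝ)) :=
    (isSemialgebraicFunOn_aeval s2_isSemialgebraic_lowerCell (1 : MvPolynomial (Fin 2) ℚ)).congr
      fun x _ => by simp
  have hzm1 := IsSemialgebraicFunOn.sub_holds hz h1
  have hsq := IsSemialgebraicFunOn.mul_holds hzm1 hzm1
  refine ((hsq.neg).div hz fun x hx => ?_).congr fun x _ => ?_
  · obtain ⟨h0, h1', h2, -⟩ := hx
    have hN : 0 < 1 - x 0 - x 1 := by linarith
    have h1v : 0 < 1 - x 1 := by linarith
    exact (Real.rpow_pos_of_pos (div_pos (mul_pos h1' h1v) hN) _).ne'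
  · simp only [Pi.neg_apply, Pi.mul_apply, Pi.sub_apply]
    ring

/-- The chart `Φ(u,v) = (u, a(u,v))` is a `ℚ`-semialgebraic map on the lower cell. [folklore] -/
theorem s2_isSemialgebraicMapOn_chart :
    IsSemialgebraicMapOn ℚ {x : Fin 2 → ℝ | 0 < x 0 ∧ 0 < x 1 ∧ x 1 < 1 - x 0 ∧ x 0 < (1 - x 1) ^ 2}
      (fun y : Fin 2 → ℝ => (![y 0, -((y 1 * (1 - y 1) / (1 - y 0 - y 1)) ^ ((1:ℝ)/3) - 1) ^ 2 /
        (y 1 * (1 - y 1) / (1 - y 0 - y 1)) ^ ((1:ℝ)/3)] : Fin 2 → ℝ)) := by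
  refine IsSemialgebraicMapOn.of_forall s2_isSemialgebraic_lowerCell (Fin.forall_fin_two.mpr ⟨?_, ?_⟩)
  · exact (isSemialgebraicFunOn_aeval s2_isSemialgebraic_lowerCell (X 0)).congr fun x _ => by simp
  · exact s2_isSemialgebraicFunOn_chart₂.congr fun x _ => rfl

/-- The target density `(3/2)·u^{s−1}/√Q(a,u)` is `ℚ`-semialgebraic on `Σ_neg` (where `Q > 0`):
it is the Euler–Mellin monomial `(3/2)·u^{s−1}·Q^{−1/2}`. (The semialgebraicity of `Σ_neg` itself is
taken as a hypothesis; it is `s4_isSemialgebraic_neg` of the stub-S4 file.) [folklore] -/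
theorem s2_isSemialgebraicFunOn_target (s : ℚ)
    (hS : IsSemialgebraic ℚ {x : Fin 2 → ℝ | 0 < x 0 ∧ x 0 < 1 ∧ x 1 < 0}) :
    IsSemialgebraicFunOn ℚ {x : Fin 2 → ℝ | 0 < x 0 ∧ x 0 < 1 ∧ x 1 < 0}
      (fun x : Fin 2 → ℝ => 3 / 2 * ((x 0) ^ ((s:ℝ) - 1) /
        Real.sqrt ((x 1) ^ 2 * (3 - x 1) ^ 2 - 4 * x 0 * x 1))) := by
  have hmel := isSemialgebraicFunOn_mellinIntegrand hS
    (![X 0, X 1 ^ 2 * (3 - X 1) ^ 2 - 4 * X 0 * X 1] : Fin 2 → MvPolynomial (Fin 2) ℚ)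
    (![s - 1, -1/2]) (3/2) ?_
  · refine hmel.congr fun x hx => ?_
    obtain ⟨h0, -, ha⟩ := hx
    have h3 : aeval x (3 : MvPolynomial (Fin 2) ℚ) = (3 : ℝ) := by
      rw [show (3 : MvPolynomial (Fin 2) ℚ) = C 3 by simp [map_ofNat], MvPolynomial.aeval_C]; simp
    have h4 : aeval x (4 : MvPolynomial (Fin 2) ℚ) = (4 : ℝ) := by
      rw [show (4 : MvPolynomial (Fin 2) ℚ) = C 4 by simp [map_ofNat], MvPolynomial.aeval_C]; simp
    have hQ : 0 < x 1 ^ 2 * (3 - x 1) ^ 2 - 4 * x 0 * x 1 := by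
      have : 0 ≤ x 1 ^ 2 * (3 - x 1) ^ 2 := by positivity
      nlinarith [mul_pos h0 (neg_pos.mpr ha)]
    simp only [mellinIntegrand, Fin.prod_univ_two, Matrix.cons_val_zero, Matrix.cons_val_one,
      map_sub, map_mul, map_pow, MvPolynomial.aeval_X, h3, h4, Rat.cast_sub, Rat.cast_one,
      Rat.cast_div, Rat.cast_neg, Rat.cast_ofNat]
    rw [show (-1/2 : ℝ) = -(1/2) by norm_num, Real.rpow_neg hQ.le, ← Real.sqrt_eq_rpow]
    simp only [div_eq_mul_inv]
  · intro x hx k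
    obtain ⟨h0, -, ha⟩ := hx
    have h3 : aeval x (3 : MvPolynomial (Fin 2) ℚ) = (3 : ℝ) := by
      rw [show (3 : MvPolynomial (Fin 2) ℚ) = C 3 by simp [map_ofNat], MvPolynomial.aeval_C]; simp
    have h4 : aeval x (4 : MvPolynomial (Fin 2) ℚ) = (4 : ℝ) := by
      rw [show (4 : MvPolynomial (Fin 2) ℚ) = C 4 by simp [map_ofNat], MvPolynomial.aeval_C]; simp
    have hQ : 0 < x 1 ^ 2 * (3 - x 1) ^ 2 - 4 * x 0 * x 1 := by
      have : 0 ≤ x 1 ^ 2 * (3 - x 1) ^ 2 := by positivity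
      nlinarith [mul_pos h0 (neg_pos.mpr ha)]
    fin_cases k
    · simpa using h0
    · simpa [h3, h4] using hQ

end Summit.KontsevichZagierPeriods.TerasomaMultiplication.MultiplicationThreeBolza

end
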